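import Mathlib
import HarnessLib
import Summits.RiemannHypothesis.RiemannHypothesis.Theses.RuelleBand
import Summits.RiemannHypothesis.RiemannHypothesis.Theorems.RuelleBandAsymptoticToRealisation
import Summits.RiemannHypothesis.RiemannHypothesis.Theorems.RuelleBandRealisationToAsymptotic
import Summits.RiemannHypothesis.RiemannHypothesis.Theorems.RuelleBandBandEngineCore
import Summits.RiemannHypothesis.RiemannHypothesis.Theorems.AsymptoticCriticalLine.Negative.BandForms

/-!
# RuelleBand / `BandRealisation`: the equivalence with the crux; ONE-SIDED, `r_ess ≤ 1` SHADOWS SUFFICE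

Route `RiemannHypothesis/RuelleBand`, item stmt-RiemannHypothesis-2062 (`BandRealisation`, support
rank 3), helper file (`--supports`). Everything is proved; no definitions.

1. `bandRealisation_iff_asymptoticCriticalLine` assembles the two landed halves (the closed support
   items `realisationToAsymptotic_proof`, `asymptoticToRealisation_proof`; the same implications are
   also in `RuelleBandBandRealisation.lean` / `RuelleBandBandRealisationEngine.lean`): the item is
   EXACTLY as open as the crux `AsymptoticCriticalLine` (stmt-RiemannHypothesis-2063), and closes by
   `asymptoticToRealisation_proof h` the moment that crux lands (and `RiemannHypothesis →
   BandRealisation` is `bandRealisation_of_riemannHypothesis` in `RuelleBandBandRealisation.lean`: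
   a refutation of the item refutes RH).

2. IDLE CLAUSES / THE WEAKEST LANDING TYPE (serves the route's typing constraints (α), (γ) and the
   one-sided, `t ≥ 0`, Lasota–Yorke programme item). In `BandRealisation` the clauses `T 0 = id` and
   the GROUP LAW `T (s + t) = T s ∘ T t` — hence the invertibility of `T t₀` that the abstract
   two-sided engine `BandEngine` genuinely needs (bilateral shift minus a rank-one operator) — are
   idle for `ζ`, and so is UNITARITY of the principal part: it may be replaced by "spectrum in the
   closed unit disc", i.e. by the essential-spectral-radius form `T t₀ = S + K`, `K` compact,
   `σ(S) ⊆ {‖μ‖ ≤ 1}` that a Hennion / Lasota–Yorke inequality outputs. Precisely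
   (`bandRealisation_iff_essRadius`, `bandRealisation_iff_oneSided`): `BandRealisation` is equivalent
   to the existence of a complex Hilbert space and an ARBITRARY family `T : ℝ → (H →L[ℂ] H)` with
   `T t₀ - S` compact for some `t₀ > 0` and some `S` with `σ(S)` in the closed unit disc, such that
   every zero `ρ` of the open strip has a vector `v ≠ 0` with `T t v = e^{t(ρ - 1/2)} v` for all
   `t ≥ 0` only. Proof of the non-trivial direction (`asymptoticCriticalLine_of_essRadiusRealisation`):
   the EXTERIOR half of the analytic Fredholm alternative needs neither invertibility nor unitarity —
   on `{1 < ‖μ‖} ⊆ ρ(S)` the spectrum of `S + K` is discrete with a resolvent point at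
   `‖μ‖ > ‖T t₀‖‖1‖` (tree: `spectrum_add_compact_isolated_eigenvalues`,
   `RuelleBand.finite_spectrum_inter_of_isolated`, `RuelleBand.finiteDimensional_eigenspace_add_compact`),
   so the one-sided joint eigenvalues `z` with `Re z ≥ ε` are finitely many
   (`finite_jointEigenvalues_re_ge_of_spectrum_subset`; fibres are finite because joint eigenvectors
   with distinct characters are separated at a POSITIVE time, `RuelleBand.exists_time_injective`);
   this gives finiteness of the RIGHT half-bands `1/2 + ε ≤ Re ρ < 1`, and the symmetry `ρ ↦ 1 - ρ`
   of the zero set (tree: `AsymptoticCriticalLine.Negative.acl_iff_rightBand`) gives the crux; the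
   converse is the landed diagonal model. (Faure–Tsujii 2013 §3; Reed–Simon I Thm VI.14;
   Hennion 1993 for the `r_ess` reading.)
-/

noncomputable section

-- D-0017: `Summit.<S>.<S>.…` is the designed namespace of a single-problem summit.
set_option linter.dupNamespace false

namespace Summit.RiemannHypothesis.RiemannHypothesis.Theorems

open Complex Filter Topology Set Metric
open Summit.RiemannHypothesis.RiemannHypothesis.Theses.RuelleBand
open Literature.Analysis.OperatorTheory

/-- **`BandRealisation ⟺ AsymptoticCriticalLine`.** The route's HONESTY clause as one theorem:
the typed shadow of the construction (item stmt-RiemannHypothesis-2062) carries exactly the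
zero-side content of the crux rung #4 (stmt-RiemannHypothesis-2063) — forward by the Faure–Tsujii
engine (closed support `realisationToAsymptotic_proof`), backward by the diagonal model on `ℓ²`
(closed support `asymptoticToRealisation_proof`). [folklore] -/
theorem bandRealisation_iff_asymptoticCriticalLine : BandRealisation ↔ AsymptoticCriticalLine :=
  ⟨fun h => realisationToAsymptotic_proof h, fun h => asymptoticToRealisation_proof h⟩

variable {H : Type} [NormedAddCommGroup H] [InnerProductSpace ℂ H] [CompleteSpace H]

omit [CompleteSpace H] in
/-- One-sided joint eigenvectors (`T t (v i) = e^{t z_i} v i` for `t ≥ 0` only) with pairwise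
distinct exponents are linearly independent: they are eigenvectors of the single operator `T t₁`
for pairwise distinct eigenvalues at a suitable POSITIVE time `t₁`
(`RuelleBand.exists_time_injective`). [folklore] -/
theorem linearIndependent_of_jointEigenvector_nonneg (T : ℝ → H →L[ℂ] H) {ι : Type*} [Fintype ι]
    (z : ι → ℂ) (hz : Function.Injective z) (v : ι → H) (hv0 : ∀ i, v i ≠ 0)
    (hv : ∀ i (t : ℝ), 0 ≤ t → T t (v i) = Complex.exp ((t : ℂ) * z i) • v i) :
    LinearIndependent ℂ v := by
  obtain ⟨t₁, ht₁, hinj⟩ := RuelleBand.exists_time_injective z hz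
  refine Module.End.eigenvectors_linearIndependent' ((T t₁ : H →L[ℂ] H) : H →ₗ[ℂ] H)
    (fun i => Complex.exp ((t₁ : ℂ) * z i)) hinj v fun i => ?_
  exact Module.End.hasEigenvector_iff.2 ⟨Module.End.mem_eigenspace_iff.2 (hv i t₁ ht₁.le), hv0 i⟩

omit [CompleteSpace H] in
/-- ONE-SIDED FINITE FIBRES: if `T t₀ = A` (`t₀ ≥ 0`) and the eigenspace `ker (A - μ)` is
finite-dimensional, only finitely many one-sided joint eigenvalues `z` (`T t v = e^{tz} v` for all
`t ≥ 0`, some `v ≠ 0`) have `e^{t₀ z} = μ`: `d + 1` of them would give `d + 1` linearly independent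
vectors in the `d`-dimensional eigenspace. [folklore] -/
theorem finite_fibre_of_finiteDimensional_nonneg (T : ℝ → H →L[ℂ] H) {t₀ : ℝ} (ht₀ : 0 ≤ t₀)
    (A : H →L[ℂ] H) (hA : T t₀ = A) (μ : ℂ)
    (hfin : FiniteDimensional ℂ
      (LinearMap.ker ((A - μ • (1 : H →L[ℂ] H) : H →L[ℂ] H) : H →ₗ[ℂ] H))) :
    {z : ℂ | Complex.exp ((t₀ : ℂ) * z) = μ ∧
      ∃ v : H, v ≠ 0 ∧ ∀ t : ℝ, 0 ≤ t → T t v = Complex.exp ((t : ℂ) * z) • v}.Finite := by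
  classical
  set E : Submodule ℂ H := LinearMap.ker ((A - μ • (1 : H →L[ℂ] H) : H →L[ℂ] H) : H →ₗ[ℂ] H)
    with hE
  set d : ℕ := Module.finrank ℂ E with hd
  by_contra hinf
  obtain ⟨s, hsub, hcard⟩ := Set.Infinite.exists_subset_card_eq hinf (d + 1)
  -- choose one-sided joint eigenvectors for the `d + 1` points of `s`
  have hmem : ∀ z : s, ∃ v : H, v ≠ 0 ∧
      ∀ t : ℝ, 0 ≤ t → T t v = Complex.exp ((t : ℂ) * (z : ℂ)) • v :=
    fun z => (hsub z.2).2
  choose v hv0 hv using hmem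
  have hzinj : Function.Injective (fun z : s => (z : ℂ)) := Subtype.coe_injective
  have hli : LinearIndependent ℂ v :=
    linearIndependent_of_jointEigenvector_nonneg T (fun z : s => (z : ℂ)) hzinj v hv0 hv
  -- the eigenvectors lie in the eigenspace `E`
  have hvE : ∀ z : s, v z ∈ E := by
    intro z
    have h1 := hv z t₀ ht₀
    rw [hA, (hsub z.2).1] at h1
    refine LinearMap.mem_ker.2 ?_
    simp only [ContinuousLinearMap.coe_coe]
    have h2 : (A - μ • (1 : H →L[ℂ] H)) (v z) = A (v z) - μ • v z := rfl
    rw [h2, h1, sub_self]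
  -- restrict to `E` and count
  set w : s → E := fun z => ⟨v z, hvE z⟩ with hw
  have hli' : LinearIndependent ℂ w := by
    refine LinearIndependent.of_comp E.subtype ?_
    convert hli using 1
    funext z
    simp [hw]
  haveI : FiniteDimensional ℂ E := hfin
  have hle := hli'.fintype_card_le_finrank
  rw [← hd, Fintype.card_coe, hcard] at hle
  omega

/-- **ONE-SIDED EXTERIOR ENGINE, `r_ess ≤ 1` form (no group law, no invertibility, no
unitarity).** Let `T : ℝ → (H →L[ℂ] H)` be ANY family of bounded operators on a complex Hilbert
space with `T t₀ - S` compact for some `t₀ > 0` and some `S` whose spectrum lies in the closed unit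
disc. Then for every `ε > 0` the one-sided joint eigenvalues `z` (`T t v = e^{tz} v` for all
`t ≥ 0`, some `v ≠ 0`) with `Re z ≥ ε` form a finite set. The eigenvalue `e^{t₀ z}` of
`T t₀ = S + K` has modulus in `[e^{t₀ ε}, ‖T t₀‖‖1‖]`, a compact part of the exterior
`{1 < ‖μ‖} ⊆ ρ(S)` of the unit disc, on which the analytic Fredholm alternative (tree:
`spectrum_add_compact_isolated_eigenvalues`, non-degenerate at any `‖μ₀‖ > ‖T t₀‖‖1‖`) leaves
finitely many spectral points, each with a finite-dimensional eigenspace (Riesz) carrying finitely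
many joint exponents (`finite_fibre_of_finiteDimensional_nonneg`). Contrast: the DISC side
`Re z ≤ -ε` genuinely needs invertibility of `T t₀` (bilateral shift minus `e₁ ⊗ e₀*`).
(Faure–Tsujii 2013 §3; Reed–Simon I, Thm VI.14; the hypothesis is Hennion's output `r_ess ≤ 1`.)
[folklore] -/
theorem finite_jointEigenvalues_re_ge_of_spectrum_subset (T : ℝ → H →L[ℂ] H) {t₀ : ℝ}
    (ht₀ : 0 < t₀) {S : H →L[ℂ] H} (hS : spectrum ℂ S ⊆ closedBall (0 : ℂ) 1)
    (hK : IsCompactOperator (T t₀ - S)) {ε : ℝ} (hε : 0 < ε) :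
    {z : ℂ | ε ≤ z.re ∧
      ∃ v : H, v ≠ 0 ∧ ∀ t : ℝ, 0 ≤ t → T t v = Complex.exp ((t : ℂ) * z) • v}.Finite := by
  have hSK : T t₀ = S + (T t₀ - S) := (add_sub_cancel S (T t₀)).symm
  -- a priori bound on the spectrum of `T t₀`
  have hbound : ∀ μ ∈ spectrum ℂ (T t₀), ‖μ‖ ≤ ‖T t₀‖ * ‖(1 : H →L[ℂ] H)‖ :=
    fun μ hμ => spectrum.norm_le_norm_mul_of_mem hμ
  set R : ℝ := ‖T t₀‖ * ‖(1 : H →L[ℂ] H)‖ with hRdef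
  have hR0 : 0 ≤ R := by positivity
  -- the exterior of the closed unit disc: open, connected, inside `ρ(S)`
  set D : Set ℂ := {μ : ℂ | 1 < ‖μ‖} with hDdef
  have hD : IsOpen D := isOpen_lt continuous_const continuous_norm
  have hDc : IsConnected D := by
    have h := RuelleBand.isConnected_exterior 0
    simpa only [Real.exp_zero, hDdef] using h
  have hDS : D ⊆ resolventSet ℂ S := by
    intro μ hμ
    rw [spectrum.mem_resolventSet_iff, ← spectrum.notMem_iff]
    intro hμσ
    have h1 := hS hμσ
    rw [mem_closedBall, dist_zero_right] at h1
    have h2 : 1 < ‖μ‖ := hμ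
    linarith
  -- a resolvent point of `T t₀` far out in `D`
  set μ₀ : ℂ := ((R + 2 : ℝ) : ℂ) with hμ₀def
  have hμ₀n : ‖μ₀‖ = R + 2 := by
    rw [hμ₀def, Complex.norm_real, Real.norm_of_nonneg (by linarith)]
  have hμ₀D : μ₀ ∈ D := by
    show 1 < ‖μ₀‖
    rw [hμ₀n]; linarith
  have hμ₀ρ : μ₀ ∈ resolventSet ℂ (S + (T t₀ - S)) := by
    rw [← hSK, spectrum.mem_resolventSet_iff, ← spectrum.notMem_iff]
    intro hσ
    have := hbound μ₀ hσ
    rw [hμ₀n] at this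
    linarith
  obtain ⟨h1, -⟩ :=
    spectrum_add_compact_isolated_eigenvalues S (T t₀ - S) hK hD hDc hDS hμ₀D hμ₀ρ
  -- the compact annulus carrying every relevant eigenvalue
  set C : Set ℂ := {μ : ℂ | Real.exp (t₀ * ε) ≤ ‖μ‖ ∧ ‖μ‖ ≤ R + 1} with hCdef
  have hCc : IsCompact C := by
    refine (isCompact_closedBall (0 : ℂ) (R + 1)).of_isClosed_subset ?_ ?_
    · exact (isClosed_le continuous_const continuous_norm).inter
        (isClosed_le continuous_norm continuous_const)
    · rintro μ ⟨-, h2⟩; simpa using h2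
  have hexp1 : 1 < Real.exp (t₀ * ε) := Real.one_lt_exp_iff.2 (by positivity)
  have hCD : C ⊆ D := fun μ hμ => lt_of_lt_of_le hexp1 hμ.1
  -- finitely many spectral points of `S + K` on `C`, each with finite fibre
  have hA : (spectrum ℂ (S + (T t₀ - S)) ∩ C).Finite :=
    RuelleBand.finite_spectrum_inter_of_isolated (S + (T t₀ - S)) h1 hCc hCD
  have hF : ∀ μ ∈ spectrum ℂ (S + (T t₀ - S)) ∩ C,
      {z : ℂ | Complex.exp ((t₀ : ℂ) * z) = μ ∧
        ∃ v : H, v ≠ 0 ∧ ∀ t : ℝ, 0 ≤ t → T t v = Complex.exp ((t : ℂ) * z) • v}.Finite := by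
    rintro μ ⟨-, hμC⟩
    exact finite_fibre_of_finiteDimensional_nonneg T ht₀.le (S + (T t₀ - S)) hSK μ
      (RuelleBand.finiteDimensional_eigenspace_add_compact S (T t₀ - S) hK (hDS (hCD hμC)))
  refine (hA.biUnion hF).subset ?_
  rintro z ⟨hz, v, hv0, hv⟩
  have hσT : Complex.exp ((t₀ : ℂ) * z) ∈ spectrum ℂ (T t₀) :=
    RuelleBand.exp_mem_spectrum_of_jointEigenvector T t₀ hv0 (hv t₀ ht₀.le)
  have hσ : Complex.exp ((t₀ : ℂ) * z) ∈ spectrum ℂ (S + (T t₀ - S)) := by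
    rw [← hSK]; exact hσT
  have hC : Complex.exp ((t₀ : ℂ) * z) ∈ C := by
    refine ⟨?_, ?_⟩
    · rw [Complex.norm_exp, Complex.re_ofReal_mul]
      exact Real.exp_le_exp.2 (by nlinarith)
    · exact (hbound _ hσT).trans (by linarith)
  exact mem_biUnion (show Complex.exp ((t₀ : ℂ) * z) ∈ spectrum ℂ (S + (T t₀ - S)) ∩ C from
    ⟨hσ, hC⟩) ⟨rfl, v, hv0, hv⟩

/-- The unitary special case of `finite_jointEigenvalues_re_ge_of_spectrum_subset` (`σ(U)` lies on
the unit circle, Mathlib `spectrum.subset_circle_of_unitary`): one-sided joint eigenvalues with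
`Re z ≥ ε` of any family with `T t₀ - U` compact, `U` unitary, are finitely many. [folklore] -/
theorem finite_jointEigenvalues_re_ge_oneSided (T : ℝ → H →L[ℂ] H) {t₀ : ℝ} (ht₀ : 0 < t₀)
    {U : H →L[ℂ] H} (hU : U ∈ unitary (H →L[ℂ] H)) (hK : IsCompactOperator (T t₀ - U))
    {ε : ℝ} (hε : 0 < ε) :
    {z : ℂ | ε ≤ z.re ∧
      ∃ v : H, v ≠ 0 ∧ ∀ t : ℝ, 0 ≤ t → T t v = Complex.exp ((t : ℂ) * z) • v}.Finite :=
  finite_jointEigenvalues_re_ge_of_spectrum_subset T ht₀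
    ((spectrum.subset_circle_of_unitary hU).trans sphere_subset_closedBall) hK hε

omit [CompleteSpace H] in
/-- Bookkeeping: the character of `BandRealisation` at a zero `s` is the engine's character at the
exponent `z = s - 1/2`, whose real part is `Re s - 1/2`. [folklore] -/
theorem re_sub_half (s : ℂ) : (s - 1 / 2).re = s.re - 1 / 2 := by
  simp [Complex.sub_re]

/-- **`r_ess ≤ 1` ONE-SIDED SHADOW ⟹ CRUX.** If some complex Hilbert space carries an ARBITRARY
family `T : ℝ → (H →L[ℂ] H)` (no group law, no `T 0 = id`, no continuity) with `T t₀ = S + K` for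
some `t₀ > 0`, `K` compact and `σ(S)` in the closed unit disc, in which every zero `ρ` of `ζ` in
the open strip has a vector `v ≠ 0` with `T t v = e^{t(ρ - 1/2)} v` for all `t ≥ 0`, then
`AsymptoticCriticalLine` holds: the right half-bands `1/2 + ε ≤ Re ρ < 1` inject (`ρ ↦ ρ - 1/2`)
into the finite sets of the exterior engine `finite_jointEigenvalues_re_ge_of_spectrum_subset`, and
the symmetry `ρ ↦ 1 - ρ` of the zero set (`AsymptoticCriticalLine.Negative.acl_iff_rightBand`)
supplies the left half-bands. So the semigroup / one-sided / `r_ess ≤ 1` landing type of the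
construction already reaches rung #4. [folklore] -/
theorem asymptoticCriticalLine_of_essRadiusRealisation
    (h : ∃ (H : Type) (_ : NormedAddCommGroup H) (_ : InnerProductSpace ℂ H) (_ : CompleteSpace H)
      (T : ℝ → H →L[ℂ] H),
      (∃ t₀ : ℝ, 0 < t₀ ∧ ∃ S : H →L[ℂ] H, spectrum ℂ S ⊆ closedBall (0 : ℂ) 1 ∧
        IsCompactOperator (T t₀ - S)) ∧
      (∀ s : ℂ, riemannZeta s = 0 → 0 < s.re → s.re < 1 →
        ∃ v : H, v ≠ 0 ∧ ∀ t : ℝ, 0 ≤ t → T t v = Complex.exp (↑t * (s - 1 / 2)) • v)) :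
    AsymptoticCriticalLine := by
  obtain ⟨H, _, _, _, T, ⟨t₀, ht₀, S, hS, hK⟩, heig⟩ := h
  rw [AsymptoticCriticalLine.Negative.acl_iff_rightBand]
  intro ε hε
  have hfin := finite_jointEigenvalues_re_ge_of_spectrum_subset T ht₀ hS hK hε
  refine (hfin.preimage (f := fun s : ℂ => s - 1 / 2) sub_left_injective.injOn).subset ?_
  rintro s ⟨hs, hε', h1⟩
  have h0 : 0 < s.re := by linarith
  obtain ⟨v, hv0, hv⟩ := heig s hs h0 h1
  refine ⟨?_, v, hv0, hv⟩
  rw [re_sub_half]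
  linarith

/-- **UNITARY ONE-SIDED SHADOW ⟹ CRUX** (the literal clause-drop of `BandRealisation`): as
`asymptoticCriticalLine_of_essRadiusRealisation` with `S = U` unitary. [folklore] -/
theorem asymptoticCriticalLine_of_oneSidedRealisation
    (h : ∃ (H : Type) (_ : NormedAddCommGroup H) (_ : InnerProductSpace ℂ H) (_ : CompleteSpace H)
      (T : ℝ → H →L[ℂ] H),
      (∃ t₀ : ℝ, 0 < t₀ ∧ ∃ U : H →L[ℂ] H, U ∈ unitary (H →L[ℂ] H) ∧
        IsCompactOperator (T t₀ - U)) ∧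
      (∀ s : ℂ, riemannZeta s = 0 → 0 < s.re → s.re < 1 →
        ∃ v : H, v ≠ 0 ∧ ∀ t : ℝ, 0 ≤ t → T t v = Complex.exp (↑t * (s - 1 / 2)) • v)) :
    AsymptoticCriticalLine := by
  obtain ⟨H, i1, i2, i3, T, ⟨t₀, ht₀, U, hU, hK⟩, heig⟩ := h
  exact asymptoticCriticalLine_of_essRadiusRealisation ⟨H, i1, i2, i3, T, ⟨t₀, ht₀, U,
    (spectrum.subset_circle_of_unitary hU).trans sphere_subset_closedBall, hK⟩, heig⟩

/-- **`BandRealisation` ⟺ its ONE-SIDED SHADOW** (idle-clause audit of item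
stmt-RiemannHypothesis-2062): the clauses `T 0 = id` and `T (s + t) = T s ∘ T t` of
`BandRealisation`, and the two-sidedness `t ∈ ℝ` of the joint-eigenvalue clause, can all be dropped
without changing the statement's truth value — both sides are equivalent to `AsymptoticCriticalLine`
(`asymptoticCriticalLine_of_oneSidedRealisation`, `asymptoticToRealisation_proof`). What is NOT
idle: `0 < t₀`, compactness of `T t₀ - U`, and the eigenvector clause over ALL strip zeros (refuter
notes on the item). [folklore] -/
theorem bandRealisation_iff_oneSided :
    BandRealisation ↔
    ∃ (H : Type) (_ : NormedAddCommGroup H) (_ : InnerProductSpace ℂ H) (_ : CompleteSpace H)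
      (T : ℝ → H →L[ℂ] H),
      (∃ t₀ : ℝ, 0 < t₀ ∧ ∃ U : H →L[ℂ] H, U ∈ unitary (H →L[ℂ] H) ∧
        IsCompactOperator (T t₀ - U)) ∧
      (∀ s : ℂ, riemannZeta s = 0 → 0 < s.re → s.re < 1 →
        ∃ v : H, v ≠ 0 ∧ ∀ t : ℝ, 0 ≤ t → T t v = Complex.exp (↑t * (s - 1 / 2)) • v) := by
  constructor
  · rintro ⟨H, i1, i2, i3, T, -, -, hUK, heig⟩
    exact ⟨H, i1, i2, i3, T, hUK, fun s hs h0 h1 =>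
      let ⟨v, hv0, hv⟩ := heig s hs h0 h1
      ⟨v, hv0, fun t _ => hv t⟩⟩
  · intro h
    exact bandRealisation_iff_asymptoticCriticalLine.2 (asymptoticCriticalLine_of_oneSidedRealisation h)

/-- **`BandRealisation` ⟺ the `r_ess ≤ 1` ONE-SIDED SHADOW** — the weakest landing type: an
arbitrary family `T`, one time `t₀ > 0` at which `T t₀` is a compact perturbation of an operator
with spectrum in the closed unit disc (on a Hilbert space this says `r_ess(T t₀) ≤ 1` — Stampfli's
compact perturbation `σ(A + K) = σ_Weyl(A)` gives the converse — which is what a Hennion /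
Lasota–Yorke inequality with contraction constants `e^{ε t₀}`, `ε → 0`, outputs), and one-sided
joint eigenvectors at all strip zeros. Unitarity, the group law and invertibility in `BandRealisation` are conveniences of
the diagonal witness, not requirements of the engine. [folklore] -/
theorem bandRealisation_iff_essRadius :
    BandRealisation ↔
    ∃ (H : Type) (_ : NormedAddCommGroup H) (_ : InnerProductSpace ℂ H) (_ : CompleteSpace H)
      (T : ℝ → H →L[ℂ] H),
      (∃ t₀ : ℝ, 0 < t₀ ∧ ∃ S : H →L[ℂ] H, spectrum ℂ S ⊆ closedBall (0 : ℂ) 1 ∧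
        IsCompactOperator (T t₀ - S)) ∧
      (∀ s : ℂ, riemannZeta s = 0 → 0 < s.re → s.re < 1 →
        ∃ v : H, v ≠ 0 ∧ ∀ t : ℝ, 0 ≤ t → T t v = Complex.exp (↑t * (s - 1 / 2)) • v) := by
  constructor
  · rintro ⟨H, i1, i2, i3, T, -, -, ⟨t₀, ht₀, U, hU, hK⟩, heig⟩
    exact ⟨H, i1, i2, i3, T,
      ⟨t₀, ht₀, U, (spectrum.subset_circle_of_unitary hU).trans sphere_subset_closedBall, hK⟩,
      fun s hs h0 h1 =>
        let ⟨v, hv0, hv⟩ := heig s hs h0 h1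
        ⟨v, hv0, fun t _ => hv t⟩⟩
  · intro h
    exact bandRealisation_iff_asymptoticCriticalLine.2 (asymptoticCriticalLine_of_essRadiusRealisation h)

end Summit.RiemannHypothesis.RiemannHypothesis.Theorems

end
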